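import Summits.QuantumFields.YangMills.Theorems.IR.ShellMaxCorrRungReduction

/-!
# Crux `IR` (item stmt-QuantumFields-19354) — line «maximal correlation at one physical thickness»:
BRIDGE between the two formats of the merged line (collar surrogates ⇒ shell certificate)

Helper module for item `stmt-QuantumFields-19354` (`--supports … --as helper`; it closes nothing; lead prover
ym-ir-line-mxc-p1).  The director's merged line carries two currencies for «maximal correlation ≤ const < 1 across a collar
of one physical width»: ideator ym-ir-idea-5's collar format `CollarDecoupling.CollarDecouplingAt ρ β b` (surrogates of
cube-local statistics, orthogonal-equivalent against the exterior of `Λ_{R+b}`, a quarter of the variance) and ideator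
ym-ir-idea-1's shell certificate `ShellMaxCorr.ShellCert ρ β S s θ` (`|Cov(f,g)| ≤ θ σ(f) σ(g)` for `f` on `B_R`, `g` outside
`B_{R+s}`, every `R`).  This file proves the collar currency is the STRONGER one:

* §1 geometry: every site of the torus `2S+1` is at sup-distance `≤ S`; links of `B_R` are based in the cube `Λ_R(0)`;
  links outside the open ball of radius `R'+1` are based outside `Λ_{R'}(0)`.
* §2 `shellCert_of_collarDecouplingAt` — `CollarDecouplingAt ρ β b → ShellCert ρ β S (b+2) (1/2)` for every `S`
  (surrogate swap + Cauchy–Schwarz when `R + b + 2 ≤ S`; otherwise there are no links beyond radius `S` and the far statistic is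
  constant); `shellCertificate_of_collarOnset` — per `(G, r, a)`, the body of the collar line's load (`∃ T β₂, ∀ β ≥ β₂,
  ∃ b ≥ 1, aβ·b < T ∧ CollarDecouplingAt r.ρ β b`, skeleton `Cruxes/IR/Lines/collar_decoupling.lean`) implies
  `ShellCertificate r a` (thickness `K₀ = max T 1 + 2`, `θ = 1/2`).  Hence the collar load implies the shell load `IRShellCorr`,
  and either load closes `IR` through the landed E-seams (`stub_shellEngine` p589320, `stub_collarCriterion` p590240).

HONEST FRAMING: format bookkeeping for ONE open gap-crux of a CONDITIONAL rung line; both loads stay open; no mass-gap claim.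
-/

set_option autoImplicit false

noncomputable section

open Filter Topology MeasureTheory ProbabilityTheory
open Literature.MathematicalPhysics.QuantumFieldTheory Literature.MathematicalPhysics.QuantumLattice
open Summit.QuantumFields.YangMills.Cruxes.OSLegsFromFemtoAndGap.DlrCollarTransfer (GapInUnits LowerBounds)
open Summit.QuantumFields.YangMills.Cruxes.IR.CollarDecoupling (cubeSites cubeEdges IsCubeLocal IsExteriorLocal
  CollarDecouplingAt)

namespace Summit.QuantumFields.YangMills.Cruxes.IR.ShellMaxCorr

/-! ## §1 Geometry: balls inside cubes, far links outside cubes, no links beyond radius `S` -/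

section Geometry

/-- On the torus of side `2S+1` every site is at sup-distance `≤ S` from the origin. -/
theorem siteNorm_le_half (S : ℕ) (x : Site 4 (2 * S + 1)) : siteNorm x ≤ S := by
  unfold siteNorm
  refine Finset.sup_le fun k _ => ?_
  have := ZMod.natAbs_valMinAbs_le (n := 2 * S + 1) (x k)
  omega

/-- Links of the closed ball `B_R` about the origin are based in the cube `Λ_R(0)`. -/
theorem mem_cubeEdges_of_inBall (S R : ℕ) {e : Edge 4 (2 * S + 1)} (he : InBall R e) : e ∈ cubeEdges S 0 R := by
  simp only [cubeEdges, cubeSites, Set.mem_setOf_eq, Pi.zero_apply, sub_zero]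
  intro i
  exact (natAbs_valMinAbs_apply_le_siteNorm e.1 i).trans he.1

/-- Links outside the open ball of radius `R' + 1` are based outside the cube `Λ_{R'}(0)`. -/
theorem not_mem_cubeEdges_of_outBall (S R' : ℕ) {e : Edge 4 (2 * S + 1)} (he : OutBall (R' + 1) e) :
    e ∈ (cubeEdges S 0 R')ᶜ := by
  simp only [cubeEdges, cubeSites, Set.mem_compl_iff, Set.mem_setOf_eq, Pi.zero_apply, sub_zero, not_forall, not_le]
  have h : R' < siteNorm e.1 := Nat.lt_of_lt_of_le (Nat.lt_succ_self R') he.1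
  unfold siteNorm at h
  obtain ⟨i, -, hi⟩ := Finset.lt_sup_iff.1 h
  exact ⟨i, hi⟩

end Geometry

/-! ## §2 Collar format at mesh `b` ⇒ shell certificate at thickness `b + 2` with `θ = 1/2` -/

section Bridge

variable {G : Type} [Group G] [TopologicalSpace G] [IsTopologicalGroup G] [CompactSpace G]
  [MeasurableSpace G] [BorelSpace G]

/-- **Collar decoupling ⇒ shell certificate.**  If the torus Wilson state satisfies the collar format at mesh `b`
(`CollarDecouplingAt ρ β b`: Markov-local surrogates with a quarter of the variance), then on every odd torus and for every
inner radius `R` the shell maximal correlation at thickness `b + 2` is `≤ 1/2` (`ShellCert ρ β S (b+2) (1/2)`): for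
`R + b + 2 ≤ S` swap `f` for its surrogate against the far statistic `g` (exterior to `Λ_{R+b}(0)`) and use Cauchy–Schwarz;
for larger `R` there are no links beyond radius `R + b + 2 > S`, so `g` is constant. -/
theorem shellCert_of_collarDecouplingAt {n : ℕ} (ρ : G →* Matrix (Fin n) (Fin n) ℂ) (hρ : Continuous ρ) (β : ℝ)
    {b : ℕ} (hP : CollarDecouplingAt ρ β b) (S : ℕ) : ShellCert ρ β S (b + 2) (1 / 2) := by
  intro R f g hfm hgm hfb hgb hf hg
  obtain ⟨Cf, hfC⟩ := hfb
  obtain ⟨Cg, hgC⟩ := hgb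
  set μ : Measure (GaugeConfig 4 (2 * S + 1) G) := wilsonMeasure (d := 4) (L := 2 * S + 1) ρ β with hμ
  haveI : IsProbabilityMeasure μ := isProbabilityMeasure_wilsonMeasure (d := 4) (L := 2 * S + 1) ρ hρ β
  by_cases hRS : R + b + 2 ≤ S
  · -- the collar step
    have hfcube : IsCubeLocal S 0 R f := ⟨hfm, ⟨Cf, hfC⟩, hf.mono fun e he => mem_cubeEdges_of_inBall S R he⟩
    obtain ⟨f', hf'cube, hswap, hvar⟩ := hP S 0 R hRS f hfcube
    obtain ⟨hf'm, ⟨Cf', hf'C⟩, -⟩ := id hf'cube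
    have hgext : IsExteriorLocal S 0 (R + b) g :=
      ⟨hgm, ⟨Cg, hgC⟩, hg.mono fun e he => not_mem_cubeEdges_of_outBall S (R + b) (by
        have : R + (b + 2) = R + b + 1 + 1 := by ring
        rw [this] at he; exact outBall_anti (Nat.le_succ _) he)⟩
    -- integrability
    have hfi : Integrable f μ := integrable_of_ae_bdd_abs hfm.aestronglyMeasurable (ae_of_all _ hfC)
    have hf'i : Integrable f' μ := integrable_of_ae_bdd_abs hf'm.aestronglyMeasurable (ae_of_all _ hf'C)
    have hfgi : Integrable (fun U => f U * g U) μ := by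
      refine integrable_of_ae_bdd_abs (hfm.mul hgm).aestronglyMeasurable (M := Cf * Cg)
        (ae_of_all _ fun U => ?_)
      rw [abs_mul]; exact mul_le_mul (hfC U) (hgC U) (abs_nonneg _) ((abs_nonneg _).trans (hfC U))
    have hf'gi : Integrable (fun U => f' U * g U) μ := by
      refine integrable_of_ae_bdd_abs (hf'm.mul hgm).aestronglyMeasurable (M := Cf' * Cg)
        (ae_of_all _ fun U => ?_)
      rw [abs_mul]; exact mul_le_mul (hf'C U) (hgC U) (abs_nonneg _) ((abs_nonneg _).trans (hf'C U))
    -- same mean, same pairing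
    have hmean : ∫ U, f' U ∂μ = ∫ U, f U ∂μ := by
      have h := hswap (fun _ => (1 : ℝ)) (CollarDecoupling.isExteriorLocal_const S 0 (R + b) 1)
      simp only [mul_one] at h
      rw [integral_sub hfi hf'i] at h
      linarith
    have hpair : ∫ U, f' U * g U ∂μ = ∫ U, f U * g U ∂μ := by
      have h := hswap g hgext
      have hpt : (fun U => (f U - f' U) * g U) = fun U => f U * g U - f' U * g U := by funext U; ring
      rw [hpt, integral_sub hfgi hf'gi] at h
      linarith
    have hcov : cov[f, g; μ] = cov[f', g; μ] := by
      rw [cov_eq_integral μ hfm hfC hgm hgC, cov_eq_integral μ hf'm hf'C hgm hgC, hpair, hmean]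
    -- `σ(f') ≤ σ(f)/2`
    have hσf' : Real.sqrt (Var[f'; μ]) ≤ 1 / 2 * Real.sqrt (Var[f; μ]) := by
      have hv' : Var[f'; μ] ≤ (1 / 4) * Var[f; μ] := by
        rw [variance_eq_integral hf'm.aemeasurable, variance_eq_integral hfm.aemeasurable]
        have e : (fun U => (f' U - ∫ W, f' W ∂μ) ^ 2) = fun U => (f' U - ∫ W, f W ∂μ) ^ 2 := by
          funext U; rw [hmean]
        simp only [e]
        exact hvar
      calc Real.sqrt (Var[f'; μ]) ≤ Real.sqrt ((1 / 4) * Var[f; μ]) := Real.sqrt_le_sqrt hv'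
        _ = 1 / 2 * Real.sqrt (Var[f; μ]) := by
            rw [Real.sqrt_mul (by norm_num : (0 : ℝ) ≤ 1 / 4), show Real.sqrt (1 / 4 : ℝ) = 1 / 2 by
              rw [show (1 / 4 : ℝ) = (1 / 2) ^ 2 by norm_num, Real.sqrt_sq (by norm_num)]]
    have hcs := abs_cov_le_sqrt_var μ hf'm hgm hf'C hgC
    calc |cov[f, g; μ]| = |cov[f', g; μ]| := by rw [hcov]
      _ ≤ Real.sqrt (Var[f'; μ]) * Real.sqrt (Var[g; μ]) := hcs
      _ ≤ 1 / 2 * Real.sqrt (Var[f; μ]) * Real.sqrt (Var[g; μ]) := by gcongr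
  · -- no links beyond radius `S`: `g` is constant
    have hempty : ∀ e : Edge 4 (2 * S + 1), ¬ OutBall (R + (b + 2)) e := by
      intro e he
      have := siteNorm_le_half S e.1
      have := he.1
      omega
    have hconst : g = fun _ => g (fun _ => 1) := by
      funext U
      exact hg fun e he => absurd he (hempty e)
    rw [hconst, covariance_const_right, abs_zero]
    positivity

/-- **The collar onset implies the shell certificate** (per gauge group, representation and unit).  If for all large `β`
the torus Wilson state satisfies the collar format at some mesh `b ≥ 1` of bounded physical width `a β · b < T` (the body of
the collar line's load `CollarSharpOnset` of `Cruxes/IR/Lines/collar_decoupling.lean`, for this `(G, r, a)`), then the shell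
certificate holds at the ONE physical thickness `K₀ = max T 1 + 2` with `θ = 1/2` (`ShellCertificate r a`), by
`shellCert_of_collarDecouplingAt` and monotonicity in the thickness (`a β ≤ 1` eventually since `a → 0`).  Consequently the
collar load implies the shell load `IRShellCorr`: of the two loads of the merged line the shell one is the weaker, and both
close `IR` through their landed E-seams. -/
theorem shellCertificate_of_collarOnset (r : LatticeRep G) (a : ℝ → ℝ) (ha : ∀ β, 0 < a β)
    (ha0 : Tendsto a atTop (𝓝 0))
    (h : ∃ T β₂ : ℝ, ∀ β : ℝ, β₂ ≤ β → ∃ b : ℕ, 1 ≤ b ∧ a β * (b : ℝ) < T ∧ CollarDecouplingAt r.ρ β b) :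
    ShellCertificate r a := by
  obtain ⟨T, β₂, hb⟩ := h
  -- eventually `a β ≤ 1`
  obtain ⟨β₃, hβ₃⟩ : ∃ β₃ : ℝ, ∀ β, β₃ ≤ β → a β ≤ 1 :=
    eventually_atTop.1 (ha0.eventually (eventually_le_nhds one_pos))
  refine ⟨max T 1 + 2, 1 / 2, max β₂ β₃, fun _ => 0, by positivity, by norm_num, by norm_num,
    fun β hβ S _ => ?_⟩
  obtain ⟨b, hb1, hbT, hP⟩ := hb β ((le_max_left _ _).trans hβ)
  have ha1 : a β ≤ 1 := hβ₃ β ((le_max_right _ _).trans hβ)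
  have hab : 0 < a β := ha β
  have hcert := shellCert_of_collarDecouplingAt r.ρ r.continuous β hP S
  refine shellCert_mono ?_ le_rfl hcert
  -- `b + 2 ≤ ⌈(max T 1 + 2) / a β⌉₊`
  have hreal : ((b : ℝ) + 2) ≤ (max T 1 + 2) / a β := by
    rw [le_div_iff₀ hab]
    have h1 : (b : ℝ) * a β < T := by rw [mul_comm]; exact hbT
    have h2 : T ≤ max T 1 := le_max_left _ _
    have hb0 : (0 : ℝ) ≤ b := Nat.cast_nonneg _
    nlinarith
  have hceil : ((b : ℝ) + 2) ≤ (⌈(max T 1 + 2) / a β⌉₊ : ℝ) := hreal.trans (Nat.le_ceil _)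
  exact_mod_cast hceil

end Bridge

end Summit.QuantumFields.YangMills.Cruxes.IR.ShellMaxCorr

end
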